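import Mathlib
import HarnessLib

/-!
# Crux `NNMonotoneHard` (stmt-ValiantsHypothesis-11617): rank bookkeeping for `Finset.orderEmbOfFin`

Generic counting facts used by the word model of `Cruxes/NNMonotoneHard/PROOF-PLAN.md` (pieces
(C), (D)): for a set `s` of positions in `Fin M` enumerated increasingly by
`s.orderEmbOfFin h : Fin n ↪o Fin M`, the number `rank s t = #{i ∈ s : i < t}` of elements before
time `t` controls the enumeration:

* `card_filter_lt_orderEmbOfFin` — exactly `k` elements of `s` precede the `k`-th element;
* `orderEmbOfFin_lt_iff` — the `k`-th element is `< t` iff `k < #{i ∈ s : i < t}`;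
* `orderEmbOfFin_card_filter_lt` — an element `t ∈ s` is the `#{i ∈ s : i < t}`-th element.

For the FIFO pairing of a ballot word (openers `o_k`, closers `c_k`) these say: the arcs open at
time `t` are exactly the indices `k` with `#closers<t ≤ k < #openers<t` — the queue is an interval
of arc indices, its front is `o_{#closers<t}`, a closer at time `t` is `c_{#closers<t}` and an
opener at time `t` is `o_{#openers<t}`.  Honest framing: bookkeeping only; VP ≠ VNP is not moved by
anything here.  No definitions, no named facts.
-/

-- Sub = Summit single-conjunct layout: the duplicated namespace component is mandated by the tree.
set_option linter.dupNamespace false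

namespace Summit.ValiantsHypothesis.ValiantsHypothesis.Theorems.FifoMatching.NNMonotoneHard

open Finset

variable {M n : ℕ}

/-- Every element of `s` is some `k`-th element. [folklore] -/
theorem exists_orderEmbOfFin_eq {s : Finset (Fin M)} (h : s.card = n) {t : Fin M} (ht : t ∈ s) :
    ∃ k : Fin n, s.orderEmbOfFin h k = t := by
  have : t ∈ Set.range (s.orderEmbOfFin h) := by rw [range_orderEmbOfFin]; exact mem_coe.2 ht
  exact this

/-- **Exactly `k` elements of `s` precede its `k`-th element.** [folklore] -/
theorem card_filter_lt_orderEmbOfFin {s : Finset (Fin M)} (h : s.card = n) (k : Fin n) :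
    (s.filter fun i => i < s.orderEmbOfFin h k).card = k := by
  classical
  have hset : (s.filter fun i => i < s.orderEmbOfFin h k) = (Finset.Iio k).image (s.orderEmbOfFin h) := by
    ext i
    simp only [mem_filter, mem_image, Finset.mem_Iio]
    constructor
    · rintro ⟨hi, hlt⟩
      obtain ⟨l, rfl⟩ := exists_orderEmbOfFin_eq h hi
      exact ⟨l, (s.orderEmbOfFin h).lt_iff_lt.1 hlt, rfl⟩
    · rintro ⟨l, hl, rfl⟩
      exact ⟨orderEmbOfFin_mem _ _ l, (s.orderEmbOfFin h).lt_iff_lt.2 hl⟩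
  rw [hset, card_image_of_injective _ (s.orderEmbOfFin h).injective, Fin.card_Iio]

/-- **The `k`-th element of `s` is `< t` iff `k < #{i ∈ s : i < t}`.** [folklore] -/
theorem orderEmbOfFin_lt_iff {s : Finset (Fin M)} (h : s.card = n) (k : Fin n) (t : Fin M) :
    s.orderEmbOfFin h k < t ↔ (k : ℕ) < (s.filter fun i => i < t).card := by
  classical
  constructor
  · intro hlt
    have hsub : (s.filter fun i => i < s.orderEmbOfFin h k) ∪ {s.orderEmbOfFin h k} ⊆
        s.filter fun i => i < t := by
      intro i hi
      rw [mem_union, mem_filter, mem_singleton] at hi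
      rw [mem_filter]
      rcases hi with ⟨his, hilt⟩ | rfl
      · exact ⟨his, lt_trans hilt hlt⟩
      · exact ⟨orderEmbOfFin_mem _ _ k, hlt⟩
    have hcard := card_le_card hsub
    rw [card_union_of_disjoint (by simp), card_filter_lt_orderEmbOfFin, card_singleton] at hcard
    omega
  · intro hlt
    by_contra hge
    rw [not_lt] at hge
    have hsub : (s.filter fun i => i < t) ⊆ s.filter fun i => i < s.orderEmbOfFin h k := by
      intro i hi
      rw [mem_filter] at hi ⊢
      exact ⟨hi.1, lt_of_lt_of_le hi.2 hge⟩
    have hcard := card_le_card hsub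
    rw [card_filter_lt_orderEmbOfFin] at hcard
    omega

/-- The `k`-th element of `s` is `≥ t` iff `#{i ∈ s : i < t} ≤ k`. [folklore] -/
theorem le_orderEmbOfFin_iff {s : Finset (Fin M)} (h : s.card = n) (k : Fin n) (t : Fin M) :
    t ≤ s.orderEmbOfFin h k ↔ (s.filter fun i => i < t).card ≤ (k : ℕ) := by
  rw [← not_lt, orderEmbOfFin_lt_iff, not_lt]

/-- The rank of an element of `s` is below `#s`. [folklore] -/
theorem card_filter_lt_lt_card {s : Finset (Fin M)} {t : Fin M} (ht : t ∈ s) :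
    (s.filter fun i => i < t).card < s.card := by
  apply card_lt_card
  rw [Finset.ssubset_iff_subset_ne]
  refine ⟨filter_subset _ _, fun heq => ?_⟩
  have : t ∈ s.filter fun i => i < t := by rw [heq]; exact ht
  exact lt_irrefl t (mem_filter.1 this).2

/-- **An element `t ∈ s` is the `#{i ∈ s : i < t}`-th element of `s`.** [folklore] -/
theorem orderEmbOfFin_card_filter_lt {s : Finset (Fin M)} (h : s.card = n) {t : Fin M}
    (ht : t ∈ s) :
    s.orderEmbOfFin h ⟨(s.filter fun i => i < t).card, h ▸ card_filter_lt_lt_card ht⟩ = t := by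
  obtain ⟨k, hk⟩ := exists_orderEmbOfFin_eq h ht
  have hkr : (k : ℕ) = (s.filter fun i => i < t).card := by
    rw [← hk, card_filter_lt_orderEmbOfFin]
  have hk' : (⟨(s.filter fun i => i < t).card, h ▸ card_filter_lt_lt_card ht⟩ : Fin n) = k :=
    Fin.ext hkr.symm
  rw [hk']
  exact hk

/-- The number of elements of `s` before time `t` is monotone in `t`. [folklore] -/
theorem card_filter_lt_mono (s : Finset (Fin M)) {t t' : Fin M} (htt' : t ≤ t') :
    (s.filter fun i => i < t).card ≤ (s.filter fun i => i < t').card :=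
  card_le_card fun i hi => by
    rw [mem_filter] at hi ⊢
    exact ⟨hi.1, lt_of_lt_of_le hi.2 htt'⟩

/-- Counting the elements of `s` in a time window: `#{i ∈ s : t ≤ i < t'}` is the difference of
the ranks. [folklore] -/
theorem card_filter_lt_sub (s : Finset (Fin M)) {t t' : Fin M} (htt' : t ≤ t') :
    (s.filter fun i => i < t').card - (s.filter fun i => i < t).card
      = (s.filter fun i => t ≤ i ∧ i < t').card := by
  classical
  have hsplit : (s.filter fun i => i < t') =
      (s.filter fun i => i < t) ∪ (s.filter fun i => t ≤ i ∧ i < t') := by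
    ext i
    simp only [mem_filter, mem_union]
    constructor
    · rintro ⟨hi, hlt⟩
      by_cases hit : i < t
      · exact Or.inl ⟨hi, hit⟩
      · exact Or.inr ⟨hi, not_lt.1 hit, hlt⟩
    · rintro (⟨hi, hlt⟩ | ⟨hi, -, hlt⟩)
      · exact ⟨hi, lt_of_lt_of_le hlt htt'⟩
      · exact ⟨hi, hlt⟩
  have hdisj : Disjoint (s.filter fun i => i < t) (s.filter fun i => t ≤ i ∧ i < t') := by
    rw [disjoint_filter]
    intro i _ hlt h
    exact absurd hlt (not_lt.2 h.1)
  rw [hsplit, card_union_of_disjoint hdisj]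
  omega

/-- Openers and closers: if `s` and `sᶜ` partition `Fin M`, the two ranks at time `t` add up to
`t`. [folklore] -/
theorem card_filter_lt_add_compl (s : Finset (Fin M)) (t : Fin M) :
    (s.filter fun i => i < t).card + (sᶜ.filter fun i => i < t).card = t := by
  classical
  have h1 : (s.filter fun i => i < t) ∪ (sᶜ.filter fun i => i < t) = Finset.Iio t := by
    ext i
    simp only [mem_union, mem_filter, mem_compl, Finset.mem_Iio]
    tauto
  have h2 : Disjoint (s.filter fun i => i < t) (sᶜ.filter fun i => i < t) := by
    rw [disjoint_left]
    intro i hi hi'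
    exact (mem_compl.1 (mem_filter.1 hi').1) (mem_filter.1 hi).1
  rw [← card_union_of_disjoint h2, h1, Fin.card_Iio]

end Summit.ValiantsHypothesis.ValiantsHypothesis.Theorems.FifoMatching.NNMonotoneHard
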